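import Summits.CriticalPhenomena.CardyFormulaZ2.Theorems.CardyIKTransportIKLinearTransportPinnedDefs
import Summits.CriticalPhenomena.CardyFormulaZ2.Theorems.CardyIKTransportIKLinearTransportDiagramExchangeGlue

/-!
# `stub_ExchangeAssembly` (crux stmt-CriticalPhenomena-5076, line pinned-diagram-exchange, skeleton v5)

The registered stub

  `stub_ExchangeAssembly : ∀ C c S i G, (i ∈ S ↔ i + 1 ∉ S) → StripDiagramExchange S i →
     PinnedSampler C c S i G → IsExchangeKernel C c S i G`

— a pinned sampler (v5 vocabulary `CardyIKTransportIKLinearTransportPinnedDefs`) together with the strip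
diagram exchange IS an exchange map in the sense of `IsExchangeKernel` (vocabulary §3; Fact 5.15 of
arXiv:2502.08394 rebuilt for the Izergin–Korepin family). Measurability, covariance (iv) and quasi-locality
(v) are verbatim clauses of `PinnedSampler`; the law transport (i) is its conditional-law clause applied to
`StripDiagramExchange S i`; (ii) holds SURELY because `eraseMid i` is preserved; (iii) — cluster membership
of cells off column `i + 1` is preserved — is the one piece of mathematics (`exa_monoCluster_congr`):
every edge of the triangulation `cellGraph` joins cells whose columns differ by at most one and is decided
by a face in the smaller of the two columns, so the monochromatic graph splits as CONTEXT (edges off cell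
column `i + 1`: unchanged, since colours agree off column `i + 1` and flags agree off face columns
`i, i + 1`) ⊔ PATCH (edges inside the strip of columns `i, i + 1, i + 2`), and the landed GLUING THEOREM
`reachable_glue_congr` (`…DiagramExchangeGlue` §3) says the patch only enters through the reachability it
induces on the boundary columns `i`, `i + 2` — which is exactly the strip diagram, equal for the two
configurations.

Contents (theorems only): §1 bookkeeping between Mathlib's `G.induce s` (graph on the subtype) and the
restriction `((⊤ : G.Subgraph).induce s).spanningCoe` (graph on the same vertex type); §2 column steps and
edge locality of `cellGraph`, the context ⊔ patch decomposition; §3 the vocabulary (`monoCluster`,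
`stripDiagram`, `eraseMid`) through restricted graphs; §4 clause (iii); §5 the stub. No literature fact
is used.
-/

noncomputable section

namespace Summit.CriticalPhenomena.CardyFormulaZ2.Theorems.IKLinearTransport.PinnedDiagramExchange

open scoped Classical MeasureTheory ENNReal symmDiff
open Set MeasureTheory
open Literature.Probability.Percolation Literature.Probability.LatticeModels

/-! ## §1 Restricting a graph to a vertex set; reachability bookkeeping

Throughout, the RESTRICTION of a graph `G` to a vertex set `s` on the same vertex type (vertices off `s`
isolated) is Mathlib's `((⊤ : G.Subgraph).induce s).spanningCoe`. -/

section Generic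

variable {V : Type*}

/-- Adjacency of the restriction of `G` to `s`. [folklore] -/
theorem exa_res_adj (G : SimpleGraph V) (s : Set V) (u v : V) :
    ((⊤ : G.Subgraph).induce s).spanningCoe.Adj u v ↔ u ∈ s ∧ v ∈ s ∧ G.Adj u v := Iff.rfl

/-- Reachability inside the subgraph induced on `s` (Mathlib's `G.induce s`, a graph on the subtype) is
reachability in the restriction of `G` to `s`. [folklore] -/
theorem exa_reachable_induce_iff (G : SimpleGraph V) (s : Set V) {a b : V} (ha : a ∈ s) :
    (∃ hb : b ∈ s, (G.induce s).Reachable ⟨a, ha⟩ ⟨b, hb⟩) ↔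
      ((⊤ : G.Subgraph).induce s).spanningCoe.Reachable a b := by
  constructor
  · rintro ⟨hb, hr⟩
    let φ : G.induce s →g ((⊤ : G.Subgraph).induce s).spanningCoe :=
      { toFun := fun v => v.1
        map_rel' := fun {u v} huv => (exa_res_adj G s _ _).2 ⟨u.2, v.2, SimpleGraph.induce_adj.1 huv⟩ }
    exact hr.map φ
  · intro hr
    rw [SimpleGraph.reachable_iff_reflTransGen] at hr
    induction hr with
    | refl => exact ⟨ha, SimpleGraph.Reachable.refl _⟩
    | tail _ hbc ih =>
      obtain ⟨hb, hrb⟩ := ih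
      obtain ⟨-, hc, hadj⟩ := (exa_res_adj G s _ _).1 hbc
      refine ⟨hc, hrb.trans (SimpleGraph.Adj.reachable ?_)⟩
      exact hadj

/-- A vertex off `s` is isolated in the restriction of `G` to `s`. [folklore] -/
theorem exa_reachable_res_of_not_mem (G : SimpleGraph V) (s : Set V) {p q : V} (hp : p ∉ s) :
    ((⊤ : G.Subgraph).induce s).spanningCoe.Reachable p q ↔ p = q := by
  constructor
  · intro h
    rw [SimpleGraph.reachable_iff_reflTransGen] at h
    rcases h.cases_head with h | ⟨c, hpc, -⟩
    · exact h
    · exact (hp ((exa_res_adj G s _ _).1 hpc).1).elim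
  · rintro rfl
    rfl

end Generic

/-! ## §2 The cell graph: column steps, locality of the edges, context ⊔ patch -/

/-- Every edge relation of the triangulation moves the column index by `0` or `+1`. [folklore] -/
theorem exa_cellRel_col {A : Set (Site 2)} {u v : Site 2}
    (h : v = u + ![1, 0] ∨ v = u + ![0, 1] ∨ (v = u + ![1, 1] ∧ u ∉ A) ∨
      (v = u + ![1, -1] ∧ (u + ![0, -1]) ∈ A)) :
    v 0 = u 0 + 1 ∨ v 0 = u 0 := by
  rcases h with rfl | rfl | ⟨rfl, -⟩ | ⟨rfl, -⟩ <;> simp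

/-- Adjacent cells of `cellGraph A` have column indices differing by at most one. [folklore] -/
theorem exa_cellGraph_adj_col {A : Set (Site 2)} {u v : Site 2} (h : (cellGraph A).Adj u v) :
    v 0 = u 0 + 1 ∨ v 0 = u 0 ∨ u 0 = v 0 + 1 := by
  simp only [cellGraph, SimpleGraph.fromRel_adj] at h
  rcases h.2 with h' | h'
  · rcases exa_cellRel_col h' with h1 | h1
    · exact Or.inl h1
    · exact Or.inr (Or.inl h1)
  · rcases exa_cellRel_col h' with h1 | h1
    · exact Or.inr (Or.inr h1)
    · exact Or.inr (Or.inl h1.symm)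

/-- LOCALITY OF THE EDGES: the edge relation between two cells off column `i + 1` only reads faces off the
face columns `i, i + 1`. [folklore] -/
theorem exa_cellRel_congr {A A' : Set (Site 2)} {i : ℤ}
    (hA : ∀ f : Site 2, f 0 ≠ i → f 0 ≠ i + 1 → (f ∈ A ↔ f ∈ A')) {u v : Site 2}
    (hu : u 0 ≠ i + 1) (hv : v 0 ≠ i + 1)
    (h : v = u + ![1, 0] ∨ v = u + ![0, 1] ∨ (v = u + ![1, 1] ∧ u ∉ A) ∨
      (v = u + ![1, -1] ∧ (u + ![0, -1]) ∈ A)) :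
    v = u + ![1, 0] ∨ v = u + ![0, 1] ∨ (v = u + ![1, 1] ∧ u ∉ A') ∨
      (v = u + ![1, -1] ∧ (u + ![0, -1]) ∈ A') := by
  rcases h with h | h | ⟨h, hf⟩ | ⟨h, hf⟩
  · exact Or.inl h
  · exact Or.inr (Or.inl h)
  · have hu' : u 0 ≠ i := by
      intro hu0; apply hv; rw [h]; simp [hu0]
    exact Or.inr (Or.inr (Or.inl ⟨h, fun hf' => hf ((hA u hu' hu).2 hf')⟩))
  · have h1 : (u + ![0, -1] : Site 2) 0 ≠ i := by
      intro hu0; apply hv; rw [h]; simp at hu0 ⊢; omega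
    have h2 : (u + ![0, -1] : Site 2) 0 ≠ i + 1 := by simpa using hu
    exact Or.inr (Or.inr (Or.inr ⟨h, (hA _ h1 h2).1 hf⟩))

/-- Two anti-diagonal sets agreeing off the face columns `i, i + 1` define the same edges between cells off
cell column `i + 1`. [folklore] -/
theorem exa_cellGraph_adj_congr {A A' : Set (Site 2)} {i : ℤ}
    (hA : ∀ f : Site 2, f 0 ≠ i → f 0 ≠ i + 1 → (f ∈ A ↔ f ∈ A')) {u v : Site 2}
    (hu : u 0 ≠ i + 1) (hv : v 0 ≠ i + 1) : (cellGraph A).Adj u v ↔ (cellGraph A').Adj u v := by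
  have hA' : ∀ f : Site 2, f 0 ≠ i → f 0 ≠ i + 1 → (f ∈ A' ↔ f ∈ A) :=
    fun f h1 h2 => (hA f h1 h2).symm
  simp only [cellGraph, SimpleGraph.fromRel_adj]
  constructor
  · rintro ⟨hne, h | h⟩
    · exact ⟨hne, Or.inl (exa_cellRel_congr hA hu hv h)⟩
    · exact ⟨hne, Or.inr (exa_cellRel_congr hA hv hu h)⟩
  · rintro ⟨hne, h | h⟩
    · exact ⟨hne, Or.inl (exa_cellRel_congr hA' hu hv h)⟩
    · exact ⟨hne, Or.inr (exa_cellRel_congr hA' hv hu h)⟩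

/-- CONTEXT ⊔ PATCH: a restricted cell graph is the join of its part off cell column `i + 1` and its part
inside the strip of cell columns `i, i + 1, i + 2` (an edge touching column `i + 1` lies in the strip).
[folklore] -/
theorem exa_res_eq_sup (G : SimpleGraph (Site 2)) (s : Set (Site 2)) (i : ℤ)
    (hG : ∀ u v, G.Adj u v → v 0 = u 0 + 1 ∨ v 0 = u 0 ∨ u 0 = v 0 + 1) :
    ((⊤ : G.Subgraph).induce s).spanningCoe =
      ((⊤ : G.Subgraph).induce (s ∩ {v | v 0 ≠ i + 1})).spanningCoe ⊔
        ((⊤ : G.Subgraph).induce (s ∩ {v | i ≤ v 0 ∧ v 0 ≤ i + 2})).spanningCoe := by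
  ext u v
  simp only [SimpleGraph.sup_adj, exa_res_adj, Set.mem_inter_iff, Set.mem_setOf_eq]
  constructor
  · rintro ⟨hu, hv, hadj⟩
    by_cases huv : u 0 ≠ i + 1 ∧ v 0 ≠ i + 1
    · exact Or.inl ⟨⟨hu, huv.1⟩, ⟨hv, huv.2⟩, hadj⟩
    · have := hG u v hadj
      refine Or.inr ⟨⟨hu, ?_, ?_⟩, ⟨hv, ?_, ?_⟩, hadj⟩ <;> omega
  · rintro (⟨⟨hu, -⟩, ⟨hv, -⟩, hadj⟩ | ⟨⟨hu, -⟩, ⟨hv, -⟩, hadj⟩) <;> exact ⟨hu, hv, hadj⟩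

/-- The patch graph's vertices off column `i + 1` lie in the boundary columns `i`, `i + 2`. [folklore] -/
theorem exa_patch_bdry (G : SimpleGraph (Site 2)) (s : Set (Site 2)) (i : ℤ) (v w : Site 2)
    (h : ((⊤ : G.Subgraph).induce (s ∩ {v | i ≤ v 0 ∧ v 0 ≤ i + 2})).spanningCoe.Adj v w)
    (hv : v ∉ {v : Site 2 | v 0 = i + 1}) : v ∈ {v : Site 2 | v 0 = i ∨ v 0 = i + 2} := by
  have h1 := ((exa_res_adj _ _ _ _).1 h).1.2
  simp only [Set.mem_setOf_eq] at h1 hv ⊢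
  omega

/-! ## §3 The vocabulary through restricted graphs -/

/-- The monochromatic cluster of `a` is reachability in the cell graph restricted to the colour class of
`a`. [folklore] -/
theorem exa_mem_monoCluster_iff (x : Obs) (a b : Site 2) :
    b ∈ monoCluster x a ↔
      ((⊤ : (cellGraph x.2).Subgraph).induce {v | v ∈ x.1 ↔ a ∈ x.1}).spanningCoe.Reachable a b := by
  unfold monoCluster
  exact exa_reachable_induce_iff (cellGraph x.2) {v | v ∈ x.1 ↔ a ∈ x.1} (b := b) Iff.rfl

/-- Membership of a pair of boundary cells in the strip diagram is reachability in the cell graph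
restricted to the part of the colour class of the first cell inside the strip. [folklore] -/
theorem exa_mem_stripDiagram_iff (i : ℤ) (x : Obs) (p q : Site 2) (hp : p 0 = i ∨ p 0 = i + 2)
    (hq : q 0 = i ∨ q 0 = i + 2) :
    (p, q) ∈ stripDiagram i x ↔
      ((⊤ : (cellGraph x.2).Subgraph).induce
        {v | (v ∈ x.1 ↔ p ∈ x.1) ∧ i ≤ v 0 ∧ v 0 ≤ i + 2}).spanningCoe.Reachable p q := by
  have h1 : i ≤ p 0 ∧ p 0 ≤ i + 2 := by
    rcases hp with h | h <;> rw [h] <;> constructor <;> linarith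
  have hps : p ∈ {v : Site 2 | (v ∈ x.1 ↔ p ∈ x.1) ∧ i ≤ v 0 ∧ v 0 ≤ i + 2} := ⟨Iff.rfl, h1⟩
  rw [← exa_reachable_induce_iff (cellGraph x.2) _ (b := q) hps]
  simp only [stripDiagram, Set.mem_setOf_eq]
  constructor
  · rintro ⟨-, -, h, _, hr⟩
    exact ⟨h, hr⟩
  · rintro ⟨h, hr⟩
    exact ⟨hp, hq, h, h1, hr⟩

/-- What `eraseMid i y = eraseMid i x` says pointwise: colours agree off cell column `i + 1`, flags agree
off face columns `i, i + 1`. [folklore] -/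
theorem exa_eraseMid_eq {i : ℤ} {x y : Obs} (h : eraseMid i y = eraseMid i x) :
    (∀ v : Site 2, v 0 ≠ i + 1 → (v ∈ y.1 ↔ v ∈ x.1)) ∧
    (∀ f : Site 2, f 0 ≠ i → f 0 ≠ i + 1 → (f ∈ y.2 ↔ f ∈ x.2)) := by
  simp only [eraseMid, Prod.mk.injEq] at h
  obtain ⟨h1, h2⟩ := h
  constructor
  · intro v hv
    have h' := Set.ext_iff.1 h1 v
    simp only [Set.mem_setOf_eq] at h'
    exact ⟨fun h => (h'.1 ⟨h, hv⟩).1, fun h => (h'.2 ⟨h, hv⟩).1⟩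
  · intro f hf1 hf2
    have h' := Set.ext_iff.1 h2 f
    simp only [Set.mem_setOf_eq] at h'
    exact ⟨fun h => (h'.1 ⟨h, hf1, hf2⟩).1, fun h => (h'.2 ⟨h, hf1, hf2⟩).1⟩

/-- Off cell column `i + 1`, the CONTEXT graphs (colour class of `a` restricted off column `i + 1`) of two
configurations with the same erased data coincide. [folklore] -/
theorem exa_context_eq {i : ℤ} {x y : Obs}
    (hcol : ∀ v : Site 2, v 0 ≠ i + 1 → (v ∈ y.1 ↔ v ∈ x.1))
    (hflag : ∀ f : Site 2, f 0 ≠ i → f 0 ≠ i + 1 → (f ∈ y.2 ↔ f ∈ x.2)) {a : Site 2}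
    (ha : a 0 ≠ i + 1) :
    ((⊤ : (cellGraph y.2).Subgraph).induce ({v | v ∈ y.1 ↔ a ∈ y.1} ∩ {v | v 0 ≠ i + 1})).spanningCoe =
      ((⊤ : (cellGraph x.2).Subgraph).induce
        ({v | v ∈ x.1 ↔ a ∈ x.1} ∩ {v | v 0 ≠ i + 1})).spanningCoe := by
  ext u v
  simp only [exa_res_adj, Set.mem_inter_iff, Set.mem_setOf_eq]
  constructor
  · rintro ⟨⟨hu, huU⟩, ⟨hv, hvU⟩, hadj⟩
    refine ⟨⟨?_, huU⟩, ⟨?_, hvU⟩, (exa_cellGraph_adj_congr hflag huU hvU).1 hadj⟩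
    · rwa [hcol u huU, hcol a ha] at hu
    · rwa [hcol v hvU, hcol a ha] at hv
  · rintro ⟨⟨hu, huU⟩, ⟨hv, hvU⟩, hadj⟩
    refine ⟨⟨?_, huU⟩, ⟨?_, hvU⟩, (exa_cellGraph_adj_congr hflag huU hvU).2 hadj⟩
    · rw [hcol u huU, hcol a ha]; exact hu
    · rw [hcol v hvU, hcol a ha]; exact hv

/-- Reachability between boundary cells in the PATCH graph (colour class of `a` restricted to the strip) is
read from the strip diagram (first cell in the class of `a`) or trivial (first cell isolated). [folklore] -/
theorem exa_patch_reachable_iff {i : ℤ} (x : Obs) {a p q : Site 2}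
    (hp : p 0 = i ∨ p 0 = i + 2) (hq : q 0 = i ∨ q 0 = i + 2) :
    ((⊤ : (cellGraph x.2).Subgraph).induce
        ({v | v ∈ x.1 ↔ a ∈ x.1} ∩ {v | i ≤ v 0 ∧ v 0 ≤ i + 2})).spanningCoe.Reachable p q ↔
      ((p ∈ x.1 ↔ a ∈ x.1) ∧ (p, q) ∈ stripDiagram i x) ∨ (¬ (p ∈ x.1 ↔ a ∈ x.1) ∧ p = q) := by
  by_cases hpa : (p ∈ x.1 ↔ a ∈ x.1)
  · have hs : ({v | v ∈ x.1 ↔ a ∈ x.1} ∩ {v | i ≤ v 0 ∧ v 0 ≤ i + 2} : Set (Site 2)) =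
        {v | (v ∈ x.1 ↔ p ∈ x.1) ∧ i ≤ v 0 ∧ v 0 ≤ i + 2} := by
      ext v
      simp only [Set.mem_inter_iff, Set.mem_setOf_eq]
      rw [hpa]
    rw [hs, ← exa_mem_stripDiagram_iff i x p q hp hq]
    simp only [hpa, true_and, not_true_eq_false, false_and, or_false]
  · rw [exa_reachable_res_of_not_mem _ _ (fun h => hpa h.1)]
    simp only [hpa, false_and, not_false_eq_true, true_and, false_or]

/-! ## §4 Clause (iii): cluster membership of off-column cells is preserved -/

/-- CLUSTER MEMBERSHIP OF OFF-COLUMN CELLS IS PRESERVED: if two observable configurations agree off the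
middle data at `i` (`eraseMid`) and have the same strip diagram at `i`, then two cells off column `i + 1`
are in the same monochromatic cluster in one iff in the other. Proof: the gluing theorem
`reachable_glue_congr` with patch interior = cell column `i + 1`, boundary = cell columns `i, i + 2`,
context = the common part of the monochromatic graph off column `i + 1`, patches = the strip parts, whose
boundary reachabilities are the (equal) strip diagrams. [folklore] -/
theorem exa_monoCluster_congr {i : ℤ} {x y : Obs} (hE : eraseMid i y = eraseMid i x)
    (hD : stripDiagram i y = stripDiagram i x) {a b : Site 2} (ha : a 0 ≠ i + 1) (hb : b 0 ≠ i + 1) :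
    b ∈ monoCluster y a ↔ b ∈ monoCluster x a := by
  obtain ⟨hcol, hflag⟩ := exa_eraseMid_eq hE
  rw [exa_mem_monoCluster_iff, exa_mem_monoCluster_iff,
    exa_res_eq_sup (cellGraph y.2) _ i (fun _ _ h => exa_cellGraph_adj_col h),
    exa_res_eq_sup (cellGraph x.2) _ i (fun _ _ h => exa_cellGraph_adj_col h),
    exa_context_eq hcol hflag ha]
  refine reachable_glue_congr {v : Site 2 | v 0 = i + 1} {v : Site 2 | v 0 = i ∨ v 0 = i + 2} _ _ _
    (fun v w h => ((exa_res_adj _ _ _ _).1 h).1.2) (exa_patch_bdry _ _ i) (exa_patch_bdry _ _ i)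
    (fun p q hp hq => ?_) ha hb
  have hpU : p 0 ≠ i + 1 := by simp only [Set.mem_setOf_eq] at hp; omega
  rw [exa_patch_reachable_iff y hp hq, exa_patch_reachable_iff x hp hq, hD, hcol p hpU, hcol a ha]

/-! ## §5 The registered stub -/

/-- REGISTERED STUB `stub_ExchangeAssembly` of the line `pinned-diagram-exchange` (skeleton v5): a pinned
sampler `G` (measurable, rewriting only the middle data, preserving the strip diagram, vertically
covariant, transporting the law given `StripDiagramExchange`, exponentially quasi-local) IS an exchange
map in the sense of `IsExchangeKernel` (Fact 5.15 of arXiv:2502.08394 for the IK family). Measurability,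
(iv), (v) are verbatim; (i) is the law clause applied to `StripDiagramExchange S i`; (ii) holds surely
from `eraseMid` preservation; (iii) holds surely by `exa_monoCluster_congr`. [folklore] -/
theorem stub_ExchangeAssembly :
    ∀ (C c : ℝ) (S : Set ℤ) (i : ℤ) (G : Obs → Rnd → Obs), (i ∈ S ↔ i + 1 ∉ S) →
      StripDiagramExchange S i → PinnedSampler C c S i G → IsExchangeKernel C c S i G := by
  intro C c S i G _ hStrip hP
  obtain ⟨hmeas, herase, hdiag, hcov, hlaw, hloc⟩ := hP
  refine ⟨hmeas, hlaw hStrip, ?_, hcov, hloc⟩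
  refine Filter.Eventually.of_forall fun xu => ?_
  obtain ⟨hcol, hflag⟩ := exa_eraseMid_eq (herase xu.1 xu.2)
  exact ⟨hcol, hflag, fun a b ha hb => exa_monoCluster_congr (herase xu.1 xu.2) (hdiag xu.1 xu.2) ha hb⟩

end Summit.CriticalPhenomena.CardyFormulaZ2.Theorems.IKLinearTransport.PinnedDiagramExchange
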